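import Literature.Probability.Percolation.HalfSpace
import Mathlib.Algebra.BigOperators.Fin
import Mathlib.Algebra.Group.Subgroup.Defs
import Mathlib.Algebra.Order.Group.Action.End
import Mathlib.Algebra.Group.Action.Pretransitive
import HarnessLib
import HarnessLib.Audit

/-!
# Transplant targets V — the face-centred and body-centred cubic lattices (lane class C1b / S1) at their OWN critical points

builds on p205010 (kernel theorem, internal audit signed; external expert review pending).
Status sentence (coordinator 2026-08-20T04:30Z): "θ(p_c) = 0 on ℤ^d, all d ≥ 2 — kernel-verified (Lean 4/Mathlib,
standard axioms); internal adversarial audit SIGNED 2026-08-20 04:29Z; external expert review pending."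

STATEMENTS ONLY (lane `prim-bschramm-*`, seat `prim-bschramm-stmt`).  The tree had no percolation graph for the fcc / bcc lattices (postcont-2
`Targets.lean` §2e/2f: "DEFINITIONS MISSING"; the only `Fcc` declarations are lattice SUMS in `Literature/MathematicalPhysics/StatisticalMechanics/
HcpFccLatticeSums*.lean`).  They are defined here on integer coordinates, in the form that keeps the full cubic (hyperoctahedral) symmetry
manifest — the symmetry input `HOct 3` of the p205010 chain's block (D) (postcont-2 `USES.md` §4, class S1):

* `distSqGraph d m` — the graph on `ℤ^d` joining `x ≠ y` iff `‖x − y‖² = Σ_i (x_i − y_i)² = m` (so `distSqGraph d 1` has the edges of `zdGraph d`;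
  not recorded);
* `fccGraph` — the **face-centred cubic lattice** `D₃ = A₃ = {x ∈ ℤ³ : x₀ + x₁ + x₂ even}` with nearest-neighbour edges `‖x − y‖² = 2` (the 12
  minimal vectors `±e_i ± e_j`), i.e. `(distSqGraph 3 2).induce fccSite` (Conway–Sloane: "the fcc lattice occurs in both the `A_n` and `D_n`
  sequences as `A₃ ≅ D₃`", `D_n` = the checkerboard lattice of integer points with even coordinate sum);
* `bccGraph` — the **body-centred cubic lattice** `D₃*` rescaled by `2`: `{x ∈ ℤ³ : all x_i even or all x_i odd} = 2ℤ³ ∪ (2ℤ³ + (1,1,1))` with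
  nearest-neighbour edges `‖x − y‖² = 3` (the 8 vectors `(±1,±1,±1)`), i.e. `(distSqGraph 3 3).induce bccSite` (Conway–Sloane: the dual of fcc
  "is the body-centered cubic or bcc lattice `A₃* ≅ D₃*`").
Both are vertex-transitive (translations by lattice vectors: `isPretransitive_aut_fcc`, `isPretransitive_aut_bcc`, Mathlib class `MulAction.IsPretransitive` for the
automorphism group, from the generic `distSqGraphShiftIso`), 12- resp. 8-regular, of cubic growth, Cayley graphs of `ℤ³`, with
`p_c < 1` (they contain copies of `ℤ³`-like sublattices; not proved here).

Targets (`@[conjecture]` `Prop`s, never asserted): `FccOwnCriticalContinuity`, `BccOwnCriticalContinuity` — bond percolation on the lattice, rooted at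
the origin, dies at the lattice's OWN critical point (`theta G o (criticalProbIOf G o) = 0`, tree vocabulary `Literature/Probability/Percolation/
Percolation.lean:137-151`, `HalfSpace.lean:91`).  Printed status (lane FRESHNESS.md, 2026-08-20): OPEN — no three-dimensional Euclidean lattice
other than nearest-neighbour `ℤ³` (p205010, status sentence above) is settled in print; numerically `p_c^{bond}(fcc) ≈ 0.1202`, `p_c^{bond}(bcc) ≈ 0.1803`
(non-rigorous, not used).  Distance from the p205010 chain (`USES.md` §4 row S1): INPUT SUBSTITUTION — Kozma–Nitzan §4 / BGN re-typed with
fundamental-domain cells; no new idea expected, large typing cost.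
-/

noncomputable section

namespace Summit.CriticalPhenomena.PercolationContinuityZ3.Theorems.Transplant

open MeasureTheory Literature.Probability.Percolation Literature.Probability.LatticeModels

/-! ## Integer points at a fixed squared distance -/

/-- The graph on `ℤ^d` joining distinct `x, y` with `Σ_i (x_i − y_i)² = m`. [cite: ConwaySloane1999, Ch. 4 §7.1 (minimal vectors of D_n)] -/
def distSqGraph (d : ℕ) (m : ℤ) : SimpleGraph (Site d) where
  Adj x y := x ≠ y ∧ ∑ i, (x i - y i) ^ 2 = m
  symm := ⟨fun x y h => ⟨h.1.symm, by rw [← h.2]; exact Finset.sum_congr rfl fun i _ => by ring⟩⟩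
  loopless := ⟨fun x h => h.1 rfl⟩

/-- Adjacency in `distSqGraph`. [folklore] -/
theorem distSqGraph_adj {d : ℕ} {m : ℤ} (x y : Site d) :
    (distSqGraph d m).Adj x y ↔ x ≠ y ∧ ∑ i, (x i - y i) ^ 2 = m := Iff.rfl

/-- **Translations by vectors of an additive subgroup `S ≤ ℤ^d` are automorphisms of the induced distance graph on `S`** (they preserve
coordinate differences, hence squared distances).  This gives the vertex-transitivity of the fcc and bcc lattices below. [folklore] -/
def distSqGraphShiftIso (d : ℕ) (m : ℤ) (S : AddSubgroup (Site d)) (v : S) :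
    (distSqGraph d m).induce (S : Set (Site d)) ≃g (distSqGraph d m).induce (S : Set (Site d)) where
  toEquiv := Equiv.addRight v
  map_rel_iff' := by
    intro a b
    show (distSqGraph d m).Adj ((a : Site d) + (v : Site d)) ((b : Site d) + (v : Site d)) ↔ (distSqGraph d m).Adj a b
    simp only [distSqGraph_adj, Pi.add_apply, add_sub_add_right_eq_sub, ne_eq, add_left_inj]

/-- The automorphism group of the induced distance graph on an additive subgroup `S ≤ ℤ^d` acts transitively on `S` (Mathlib class):
translate by `-x + y`. [folklore] -/
theorem isPretransitive_aut_distSqGraph_induce (d : ℕ) (m : ℤ) (S : AddSubgroup (Site d)) :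
    MulAction.IsPretransitive
      ((distSqGraph d m).induce (S : Set (Site d)) ≃g (distSqGraph d m).induce (S : Set (Site d))) S :=
  ⟨fun x y => ⟨distSqGraphShiftIso d m S (-x + y), by
    rw [RelIso.smul_def]
    change x + (-x + y) = y
    rw [add_neg_cancel_left]⟩⟩

/-! ## The face-centred cubic lattice `D₃` -/

/-- The fcc lattice `D₃` as an additive subgroup of `ℤ³`: integer points with even coordinate sum (the "checkerboard lattice").
[cite: ConwaySloane1999, Ch. 1 §1.4 (fcc = A₃ ≅ D₃) and Ch. 4 §7.1 (D_n)] -/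
def fccSubgroup : AddSubgroup (Site 3) where
  carrier := {x | Even (x 0 + x 1 + x 2)}
  add_mem' {x y} hx hy := by
    simp only [Set.mem_setOf_eq, Pi.add_apply] at hx hy ⊢
    have : x 0 + y 0 + (x 1 + y 1) + (x 2 + y 2) = (x 0 + x 1 + x 2) + (y 0 + y 1 + y 2) := by ring
    rw [this]; exact hx.add hy
  zero_mem' := by simp
  neg_mem' {x} hx := by
    simp only [Set.mem_setOf_eq, Pi.neg_apply] at hx ⊢
    have : -x 0 + -x 1 + -x 2 = -(x 0 + x 1 + x 2) := by ring
    rw [this]; exact hx.neg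

/-- The vertex set of the fcc lattice `D₃`: integer points of `ℤ³` with even coordinate sum. [cite: ConwaySloane1999, Ch. 4 §7.1 (D_n)] -/
def fccSite : Set (Site 3) := fccSubgroup

/-- Membership in `fccSite`. [folklore] -/
theorem mem_fccSite_iff (x : Site 3) : x ∈ fccSite ↔ Even (x 0 + x 1 + x 2) := Iff.rfl

/-- The origin is an fcc site. [folklore] -/
theorem zero_mem_fccSite : (0 : Site 3) ∈ fccSite := fccSubgroup.zero_mem

/-- **The face-centred cubic lattice** as a graph: vertices `D₃ = {x ∈ ℤ³ : Σ x_i even}`, edges between points at squared distance `2` (the twelve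
nearest neighbours `x ± e_i ± e_j`, `i ≠ j`). [cite: ConwaySloane1999, Ch. 1 §1.4 (fcc = A₃ ≅ D₃) and Ch. 4 §7.1 (D_n, minimal vectors)] -/
def fccGraph : SimpleGraph fccSite :=
  (distSqGraph 3 2).induce fccSite

/-- The origin of the fcc lattice. [folklore] -/
def fccOrigin : fccSite := ⟨0, zero_mem_fccSite⟩

/-- Adjacency in the fcc lattice: distinct even-sum points at squared distance `2`. [folklore] -/
theorem fccGraph_adj (x y : fccSite) :
    fccGraph.Adj x y ↔ (x : Site 3) ≠ y ∧ ∑ i, ((x : Site 3) i - (y : Site 3) i) ^ 2 = 2 := Iff.rfl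

/-- Smoke test: `e₀ + e₁ = (1,1,0)` is an fcc neighbour of the origin. [folklore] -/
theorem fccGraph_adj_origin_example :
    fccGraph.Adj fccOrigin ⟨![1, 1, 0], by simp [mem_fccSite_iff]⟩ := by
  refine ⟨?_, ?_⟩
  · intro h
    have := congrFun h 0
    simp [fccOrigin] at this
  · simp [fccOrigin, Fin.sum_univ_three]

/-! ## The body-centred cubic lattice `D₃*` (rescaled by 2) -/

/-- The bcc lattice `2·D₃*` as an additive subgroup of `ℤ³`: integer points whose coordinates are all even or all odd
(`2ℤ³ ∪ (2ℤ³ + (1,1,1))`). [cite: ConwaySloane1999, Ch. 1 §1.4 (bcc = A₃* ≅ D₃*) and Ch. 4 §7.1] -/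
def bccSubgroup : AddSubgroup (Site 3) where
  carrier := {x | (∀ i, Even (x i)) ∨ (∀ i, Odd (x i))}
  add_mem' {x y} hx hy := by
    simp only [Set.mem_setOf_eq, Pi.add_apply] at hx hy ⊢
    rcases hx with hx | hx <;> rcases hy with hy | hy
    · exact Or.inl fun i => (hx i).add (hy i)
    · exact Or.inr fun i => (hx i).add_odd (hy i)
    · exact Or.inr fun i => (hx i).add_even (hy i)
    · exact Or.inl fun i => (hx i).add_odd (hy i)
  zero_mem' := Or.inl fun _ => by simp
  neg_mem' {x} hx := by
    simp only [Set.mem_setOf_eq, Pi.neg_apply] at hx ⊢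
    rcases hx with hx | hx
    · exact Or.inl fun i => (hx i).neg
    · exact Or.inr fun i => (hx i).neg

/-- The vertex set of the bcc lattice, scaled by `2`: integer points of `ℤ³` whose coordinates are all even or all odd.
[cite: ConwaySloane1999, Ch. 1 §1.4 (bcc = A₃* ≅ D₃*)] -/
def bccSite : Set (Site 3) := bccSubgroup

/-- Membership in `bccSite`. [folklore] -/
theorem mem_bccSite_iff (x : Site 3) : x ∈ bccSite ↔ (∀ i, Even (x i)) ∨ (∀ i, Odd (x i)) := Iff.rfl

/-- The origin is a bcc site. [folklore] -/
theorem zero_mem_bccSite : (0 : Site 3) ∈ bccSite := bccSubgroup.zero_mem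

/-- **The body-centred cubic lattice** as a graph: vertices `2·D₃* = {x ∈ ℤ³ : all coordinates even, or all odd}`, edges between points at squared
distance `3` (the eight nearest neighbours `x + (±1,±1,±1)`: cube corners ↔ body centres).
[cite: ConwaySloane1999, Ch. 1 §1.4 (bcc = A₃* ≅ D₃*) and Ch. 4 §7.1] -/
def bccGraph : SimpleGraph bccSite :=
  (distSqGraph 3 3).induce bccSite

/-- The origin of the bcc lattice. [folklore] -/
def bccOrigin : bccSite := ⟨0, zero_mem_bccSite⟩

/-- Adjacency in the bcc lattice: distinct admissible points at squared distance `3`. [folklore] -/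
theorem bccGraph_adj (x y : bccSite) :
    bccGraph.Adj x y ↔ (x : Site 3) ≠ y ∧ ∑ i, ((x : Site 3) i - (y : Site 3) i) ^ 2 = 3 := Iff.rfl

/-- Smoke test: the body centre `(1,1,1)` is a bcc neighbour of the origin. [folklore] -/
theorem bccGraph_adj_origin_example :
    bccGraph.Adj bccOrigin ⟨![1, 1, 1], (mem_bccSite_iff _).2 (Or.inr fun i => by fin_cases i <;> simp)⟩ := by
  refine ⟨?_, ?_⟩
  · intro h
    have := congrFun h 0
    simp [bccOrigin] at this
  · simp [bccOrigin, Fin.sum_univ_three]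

/-! ## Vertex-transitivity (translations) -/

/-- **The fcc lattice is vertex-transitive**: its automorphism group acts transitively (translations by `D₃`-vectors; Mathlib class).
[cite: BenjaminiSchramm1996, §2 (Cayley graphs are transitive)] -/
theorem isPretransitive_aut_fcc : MulAction.IsPretransitive (fccGraph ≃g fccGraph) fccSite :=
  isPretransitive_aut_distSqGraph_induce 3 2 fccSubgroup

/-- **The bcc lattice is vertex-transitive** (translations by lattice vectors; Mathlib class). [cite: BenjaminiSchramm1996, §2 (Cayley graphs are transitive)] -/
theorem isPretransitive_aut_bcc : MulAction.IsPretransitive (bccGraph ≃g bccGraph) bccSite :=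
  isPretransitive_aut_distSqGraph_induce 3 3 bccSubgroup

/-! ## TARGETS 2f/2g — fcc and bcc at their OWN critical points -/

/-- TARGET (OPEN — a `Prop`, never asserted): **bond percolation on the face-centred cubic lattice dies at its own critical point**,
`θ_{fcc}(p_c(fcc)) = 0` at the origin.  An instance of Benjamini–Schramm's Conjecture 4 (transitive, cubic growth, `p_c < 1`); not in print.
[cite: BenjaminiSchramm1996, Conj. 4] -/
@[conjecture] def FccOwnCriticalContinuity : Prop :=
  theta fccGraph fccOrigin (criticalProbIOf fccGraph fccOrigin) = 0

/-- TARGET (OPEN — a `Prop`, never asserted): **bond percolation on the body-centred cubic lattice dies at its own critical point**,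
`θ_{bcc}(p_c(bcc)) = 0` at the origin.  An instance of Benjamini–Schramm's Conjecture 4; not in print. [cite: BenjaminiSchramm1996, Conj. 4] -/
@[conjecture] def BccOwnCriticalContinuity : Prop :=
  theta bccGraph bccOrigin (criticalProbIOf bccGraph bccOrigin) = 0

end Summit.CriticalPhenomena.PercolationContinuityZ3.Theorems.Transplant
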